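import Mathlib.Algebra.BigOperators.Group.Finset.Basic
import Mathlib.Algebra.Order.Floor.Defs
import Mathlib.Data.Rat.Floor
import Mathlib.Data.List.GetD
import HarnessLib

/-!
# Kernel-friendly tabulated data for certificate checkers

Topic `Literature/Analysis/ValidatedNumerics`. Bookkeeping shared by the generic certificate
checkers of this directory (`SymmetricEigenCertificate.lean`, `MatrixEigenEnclosure.lean`,
`BoxCover.lean`): a certificate emitted by the compute lane is LITERAL DATA (lists of rationals,
lists of rows), and its checker is a closed Boolean term that the kernel evaluates (`decide`,
`decide +kernel`, or `native_decide` at the user's discretion). For the kernel to evaluate it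
quickly the checker must use STRUCTURAL recursion only (no well-founded recursion, no `Finset`),
while the soundness theorems are stated with `Finset.range` sums; this file provides both sides
and the bridges.

* `rsum n f` — `Σ_{k<n} f k` by structural recursion on `n`; `rsum_eq_sum`.
* `rall n P` — `∀ k < n, P k = true` as a structural Boolean; `of_rall`, `rall_eq_true_iff`.
* `vget v i`, `mget A i j` — entries of a list vector / list-of-rows matrix, `0` beyond the end
  (documented junk value: checkers only read indices below the declared sizes, and soundness
  theorems quantify over the same accessors, so no vacuity arises).
* `vtab n f`, `mtab r c f` — tabulation (materialise a computed table ONCE as a list so that the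
  kernel does not recompute it at every access); `vget_vtab`, `mget_mtab`.
* `dyFloor p x ≤ x ≤ dyCeil p x` — rounding to the dyadic grid `2^{-p}ℤ` (keeps the denominators of
  certificate data small; `den_dyFloor_dvd`, `den_dyCeil_dvd`).

The same devices appear, topic-locally, in `Literature/NumberTheory/LFunctions/WeilPositivity*.lean`
(`sumR`, `allBelow`, `getM`, `tabM`, `ratRd`); the names here are distinct so that both namespaces
can be opened together.
-/

open Finset

namespace Literature.Analysis.ValidatedNumerics

/-! ### Structural sums and universal checks -/

/-- `Σ_{k<n} f k` by structural recursion on `n` (reduces well in the kernel). [folklore] -/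
def rsum {α : Type*} [Zero α] [Add α] (n : ℕ) (f : ℕ → α) : α :=
  Nat.rec 0 (fun k acc ↦ acc + f k) n

/-- `rsum 0 f = 0`. [folklore] -/
@[simp] theorem rsum_zero {α : Type*} [Zero α] [Add α] (f : ℕ → α) : rsum 0 f = 0 := rfl

/-- `rsum (n+1) f = rsum n f + f n`. [folklore] -/
theorem rsum_succ {α : Type*} [Zero α] [Add α] (n : ℕ) (f : ℕ → α) :
    rsum (n + 1) f = rsum n f + f n := rfl

/-- `rsum n f = Σ_{k<n} f k`. [folklore] -/
theorem rsum_eq_sum {α : Type*} [AddCommMonoid α] (n : ℕ) (f : ℕ → α) :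
    rsum n f = ∑ k ∈ range n, f k := by
  induction n with
  | zero => simp
  | succ n ih => rw [rsum_succ, ih, sum_range_succ]

/-- `∀ k < n, P k` as a structural Boolean recursion. [folklore] -/
def rall (n : ℕ) (P : ℕ → Bool) : Bool :=
  Nat.rec true (fun k acc ↦ acc && P k) n

/-- `rall 0 P = true`. [folklore] -/
@[simp] theorem rall_zero (P : ℕ → Bool) : rall 0 P = true := rfl

/-- `rall (n+1) P = rall n P && P n`. [folklore] -/
theorem rall_succ (n : ℕ) (P : ℕ → Bool) : rall (n + 1) P = (rall n P && P n) := rfl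

/-- `rall n P = true ↔ ∀ k < n, P k = true`. [folklore] -/
theorem rall_eq_true_iff {n : ℕ} {P : ℕ → Bool} : rall n P = true ↔ ∀ k < n, P k = true := by
  induction n with
  | zero => simp
  | succ n ih =>
    rw [rall_succ, Bool.and_eq_true, ih]
    constructor
    · rintro ⟨h1, h2⟩ k hk
      rcases Nat.lt_succ_iff_lt_or_eq.1 hk with hk' | rfl
      · exact h1 k hk'
      · exact h2
    · intro h
      exact ⟨fun k hk ↦ h k (Nat.lt_succ_of_lt hk), h n n.lt_succ_self⟩

/-- `rall n P = true → P k = true` for `k < n`. [folklore] -/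
theorem of_rall {n : ℕ} {P : ℕ → Bool} (h : rall n P = true) {k : ℕ} (hk : k < n) : P k = true :=
  rall_eq_true_iff.1 h k hk

/-- Membership form of `of_rall`. [folklore] -/
theorem of_rall_mem {n : ℕ} {P : ℕ → Bool} (h : rall n P = true) {k : ℕ} (hk : k ∈ range n) :
    P k = true :=
  of_rall h (mem_range.1 hk)

/-! ### List vectors and matrices -/

/-- `i`-th entry of a list vector (`0` beyond the end). [folklore] -/
def vget {α : Type*} [Zero α] (v : List α) (i : ℕ) : α := v.getD i 0

/-- `(i, j)` entry of a list-of-rows matrix (`0` beyond the stored range). [folklore] -/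
def mget {α : Type*} [Zero α] (A : List (List α)) (i j : ℕ) : α := (A.getD i []).getD j 0

/-- Tabulate `f` on `range n` as a list. [folklore] -/
def vtab {α : Type*} (n : ℕ) (f : ℕ → α) : List α := (List.range n).map f

/-- Tabulate `f` on `range r × range c` as a list of rows. [folklore] -/
def mtab {α : Type*} (r c : ℕ) (f : ℕ → ℕ → α) : List (List α) :=
  (List.range r).map fun i ↦ (List.range c).map (f i)

/-- `vtab` tabulates `f`. [folklore] -/
theorem vget_vtab {α : Type*} [Zero α] {n : ℕ} (f : ℕ → α) {i : ℕ} (hi : i < n) :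
    vget (vtab n f) i = f i := by
  unfold vget vtab
  rw [List.getD_eq_getElem?_getD, List.getElem?_map, List.getElem?_range hi]
  rfl

/-- `mtab` tabulates `f`. [folklore] -/
theorem mget_mtab {α : Type*} [Zero α] {r c : ℕ} (f : ℕ → ℕ → α) {i j : ℕ} (hi : i < r)
    (hj : j < c) : mget (mtab r c f) i j = f i j := by
  unfold mget mtab
  have h1 : ((List.range r).map fun i ↦ (List.range c).map (f i)).getD i [] =
      (List.range c).map (f i) := by
    rw [List.getD_eq_getElem?_getD, List.getElem?_map, List.getElem?_range hi]
    rfl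
  rw [h1, List.getD_eq_getElem?_getD, List.getElem?_map, List.getElem?_range hj]
  rfl

/-- Length of a tabulated vector. [folklore] -/
@[simp] theorem length_vtab {α : Type*} (n : ℕ) (f : ℕ → α) : (vtab n f).length = n := by
  simp [vtab]

/-- `vget` of a cons at a successor index. [folklore] -/
@[simp] theorem vget_cons_succ {α : Type*} [Zero α] (a : α) (v : List α) (i : ℕ) :
    vget (a :: v) (i + 1) = vget v i := rfl

/-- `vget` of a cons at `0`. [folklore] -/
@[simp] theorem vget_cons_zero {α : Type*} [Zero α] (a : α) (v : List α) : vget (a :: v) 0 = a := rfl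

/-- `vget` of the empty list is the junk value `0`. [folklore] -/
@[simp] theorem vget_nil {α : Type*} [Zero α] (i : ℕ) : vget ([] : List α) i = 0 := rfl

/-- Beyond the end of the list `vget` is the junk value `0`. [folklore] -/
theorem vget_of_length_le {α : Type*} [Zero α] {v : List α} {i : ℕ} (h : v.length ≤ i) :
    vget v i = 0 :=
  List.getD_eq_default _ _ h

/-! ### Dyadic rounding -/

/-- Round down to the dyadic grid `2^{-p} ℤ`. [folklore] -/
def dyFloor (p : ℕ) (x : ℚ) : ℚ := (⌊x * 2 ^ p⌋ : ℚ) / 2 ^ p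

/-- Round up to the dyadic grid `2^{-p} ℤ`. [folklore] -/
def dyCeil (p : ℕ) (x : ℚ) : ℚ := -dyFloor p (-x)

/-- `dyFloor p x ≤ x`. [folklore] -/
theorem dyFloor_le (p : ℕ) (x : ℚ) : dyFloor p x ≤ x := by
  unfold dyFloor
  rw [div_le_iff₀ (by positivity)]
  exact Int.floor_le _

/-- `x ≤ dyCeil p x`. [folklore] -/
theorem le_dyCeil (p : ℕ) (x : ℚ) : x ≤ dyCeil p x := by
  unfold dyCeil
  have := dyFloor_le p (-x)
  linarith

/-- `x − 2^{-p} < dyFloor p x`: the rounding error is below one grid step. [folklore] -/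
theorem sub_lt_dyFloor (p : ℕ) (x : ℚ) : x - 1 / 2 ^ p < dyFloor p x := by
  unfold dyFloor
  have h := Int.sub_one_lt_floor (x * 2 ^ p)
  have hp : (0 : ℚ) < 2 ^ p := by positivity
  rw [lt_div_iff₀ hp, sub_mul, div_mul_cancel₀ _ hp.ne']
  exact h

/-- `dyFloor p x` is a dyadic rational: its denominator divides `2 ^ p`. [folklore] -/
theorem den_dyFloor_dvd (p : ℕ) (x : ℚ) : (dyFloor p x).den ∣ 2 ^ p := by
  unfold dyFloor
  have h := Rat.den_dvd ⌊x * 2 ^ p⌋ (2 ^ p)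
  rw [← Rat.intCast_div_eq_divInt] at h
  push_cast at h
  exact_mod_cast h

/-- `dyCeil p x` is a dyadic rational: its denominator divides `2 ^ p`. [folklore] -/
theorem den_dyCeil_dvd (p : ℕ) (x : ℚ) : (dyCeil p x).den ∣ 2 ^ p := by
  unfold dyCeil
  rw [Rat.neg_den]
  exact den_dyFloor_dvd p (-x)

end Literature.Analysis.ValidatedNumerics
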